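import Summits.HodgeConjecture.HodgeConjecture.Theorems.F0LD1ThetaClassTorusExtraction
import Summits.HodgeConjecture.HodgeConjecture.Theorems.F0LD1ThetaClassHermiteSum
import Summits.HodgeConjecture.HodgeConjecture.Theorems.F0LD1ThetaGermDefs
import Summits.HodgeConjecture.HodgeConjecture.Theorems.F0LD2FrameTransportPin
import Literature.NumberTheory.Automorphic.AutomorphicSpectrumProofs
import Mathlib.Analysis.Convex.Integral
import HarnessLib

-- statements over the theta-kernel datum elaborate to very large types; elaborate sequentially (as in the ★ kit lineage)
set_option Elab.async false

/-!
# (Gβ-P) `TorusProjector` — the full archimedean torus character projector as the (Gβ) brick of line LD1 (crux HLiu418)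
# (LD1-plan (g2) DEALS #7 (3); junction ★∕HOME `F0LD1ThetaSliceOfBricks`)

Cell hodgecm-mathlib, floor 0; namespace `Summit.HodgeConjecture.HodgeConjecture.Cruxes.HLiu418.F0LD1ThetaSliceTorusProjector`; seat LD1-p02 (g3);
`--supports stmt-HodgeConjecture-24832 --as helper`.  THEOREMS ONLY (no definition, no instance, no notation, no `sorry`).

For every Hermite index `β`, `P_β := Schur.charProjL μT κ_β ((rightRegular μ).restrict k)` — `k : T_∞ →* U(H)(𝔸)` the archimedean torus hom through the PINNED
transport (★ `F0LD1ArchTorusHom.exists_continuous_archTorusHom`), `μT` the Haar probability on `T_∞` (★ `exists_borel_haarProbability`), `κ_β` the one-dimensional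
character representation `z ↦ ∏_v ∏_p z_{v,p}^{n_{v,p}(β)}` (§0 `exists_charRep_prod_prod_zpow`; the ★ eigencharacter of `[θ_{h_β ⊗ Φ_f}]` for the archimedean type
`hlam.infinityType` of the splitting character) — is a bounded operator on `L²([U(H)], μ)` which (i) maps every closed `R`-invariant subspace into itself
(§0 `charProj_restrict_mem_closedSubrep`: a Bochner integral of `R(k z) v`'s against a probability measure stays in a closed convex set, Mathlib
`Convex.integral_mem`), (ii) sends every pure-tensor class `[θ_{φ ⊗ Φ_f}]` to `c_β(φ) • [θ_{h_β ⊗ Φ_f}]` (★ `F0LD1ThetaClassTorusExtraction` §4 fed by ★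
`F0LD1ThetaClassHermiteSum`), (iii) fixes `[θ_{h_β ⊗ Φ_f}]` (★ `charProj_thetaClass_follandHermite_eq_self_of_torusPin`); orbit continuity ★
`isStronglyContinuous_rightRegular_holds` + `Continuous k`, unitarity ★ `isUnitary_rightRegular`.  `torusProjector` states the brick `TorusProjector` of the junction UNFOLDED (its `∀`-body verbatim), so that the organ discharge is `F0LD1ThetaSliceOfBricks.TorusProjector := torusProjector` by `exact` once the junction file is ★.
Nothing printed is discharged.  HC_CM is proved only modulo the 7 printed citations (2 remaining: hLiu418 = stmt-HodgeConjecture-24832, h413 =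
stmt-HodgeConjecture-24833) until rung 0 closes.

References (prose locators): Bröcker–tom Dieck 1985 II (8.1), III (5.10); Borel–Jacquet 1979 §4.6; Folland 1989 §1.7; Konno–Konno 2007 Thm 5.4.
-/

set_option autoImplicit false
set_option linter.dupNamespace false

noncomputable section

open NumberField NumberField.InfinitePlace MeasureTheory IsDedekindDomain
open scoped Matrix Kronecker ComplexOrder ENNReal TensorProduct SchwartzMap InnerProductSpace ComplexConjugate Classical
open Literature.NumberTheory.Automorphic Literature.NumberTheory.Automorphic.UnitaryGroup
open Literature.NumberTheory.Automorphic.UnitaryGroup.CotangentForms (toQuotFun)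
open Literature.NumberTheory.Automorphic.UnitaryCurveForms
open Literature.NumberTheory.Automorphic.Liu2021 Literature.NumberTheory.Automorphic.Liu2021.Def411WeilCarriers
open Literature.NumberTheory.Automorphic.Liu2021.Def411WeilCarriersDoubling
open Literature.NumberTheory.Automorphic.Liu2021.CinfThetaTorus
open Literature.NumberTheory.GaloisRepresentations Literature.NumberTheory.Automorphic.IdeleClassGroup
open Literature.NumberTheory.GelbartRogawski1991 Literature.NumberTheory.GelbartRogawski1991.UnitaryDualPair
open Literature.NumberTheory.GelbartRogawski1991.UnitaryDualPair.WeilCoinv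
open Literature.NumberTheory.GelbartRogawski1991.GRConstruction
open Literature.NumberTheory.Weil1964
open Literature.RepresentationTheory.Liu2021 Literature.RepresentationTheory.HarrisKudlaSweet1996
open Literature.RepresentationTheory.HeisenbergGroup Literature.Analysis.SegalBargmann
open Literature.RepresentationTheory.KonnoKonno2007 Literature.RepresentationTheory.KonnoKonno2007.RealDualPair
open Literature.RepresentationTheory.CompactGroups
open Literature.NumberTheory.Rogawski1990
open Summit.HodgeConjecture.HodgeConjecture.Cruxes.HLiu418.F0LD1ThetaTransportKit
open Summit.HodgeConjecture.HodgeConjecture.Cruxes.HLiu418.F0LD2ThetaTensorClasses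
open Summit.HodgeConjecture.HodgeConjecture.Cruxes.HLiu418.F0LD2FrameTransportPin
open Summit.HodgeConjecture.HodgeConjecture.Cruxes.HLiu418.F0LD1ThetaGermDefs
open Summit.HodgeConjecture.HodgeConjecture.Cruxes.HLiu418.F0LD1ArchTorusHom
open Summit.HodgeConjecture.HodgeConjecture.Cruxes.HLiu418.F0LD1ThetaClassTorusExtraction
open Summit.HodgeConjecture.HodgeConjecture.Cruxes.HLiu418.F0LD1ThetaClassHermiteSum
open Literature.RepresentationTheory.FiniteGroups (isIrreducible_of_finrank_eq_one)

namespace Summit.HodgeConjecture.HodgeConjecture.Cruxes.HLiu418.F0LD1ThetaSliceTorusProjector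

/-! ## §0 Generic: character representations of a torus; character projectors preserve closed invariant subspaces -/

/-- **The character `z ↦ ∏_i ∏_j z_{i,j}^{n_{i,j}}` of the torus `(S¹)^{ι × κ}` as a one-dimensional continuous unitary IRREDUCIBLE representation on `ℂ`**
(`algebraMap ℂ (ℂ →L[ℂ] ℂ) ∘ χ_n`; irreducible by ★ `isIrreducible_of_finrank_eq_one`; unitary since `|χ_n| = 1`). [cite: BrockerTomDieck1985, II (8.1)] -/
theorem exists_charRep_prod_prod_zpow {ι κ : Type} [Fintype ι] [Fintype κ] (n : ι → κ → ℤ) :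
    ∃ ρ : ContRepresentation ℂ (ι → κ → Circle) ℂ,
      Continuous (ρ : (ι → κ → Circle) → ℂ →L[ℂ] ℂ) ∧ ρ.toRepresentation.IsIrreducible ∧
      (∀ (g : ι → κ → Circle) (x y : ℂ), ⟪ρ g x, ρ g y⟫_ℂ = ⟪x, y⟫_ℂ) ∧
      ∀ z, ρ z 1 = ∏ i, ∏ j, (((z i j : Circle) : ℂ)) ^ n i j := by
  let χ : (ι → κ → Circle) →* ℂ :=
    { toFun := fun z => ∏ i, ∏ j, (((z i j : Circle) : ℂ)) ^ n i j
      map_one' := by simp only [Pi.one_apply, Circle.coe_one, one_zpow, Finset.prod_const_one]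
      map_mul' := fun z z' => by simp only [Pi.mul_apply, Circle.coe_mul, mul_zpow, Finset.prod_mul_distrib] }
  have hχ : ∀ z, χ z = ∏ i, ∏ j, (((z i j : Circle) : ℂ)) ^ n i j := fun z => rfl
  have hχcont : Continuous χ :=
    continuous_finsetProd _ fun i _ => continuous_finsetProd _ fun j _ =>
      (continuous_subtype_val.comp ((continuous_apply j).comp (continuous_apply i))).zpow₀ _ fun z => Or.inl (Circle.coe_ne_zero _)
  have hχnorm : ∀ z, ‖χ z‖ = 1 := fun z => by
    rw [hχ, norm_prod]
    refine Finset.prod_eq_one fun i _ => ?_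
    rw [norm_prod]
    refine Finset.prod_eq_one fun j _ => ?_
    rw [norm_zpow, Circle.norm_coe, one_zpow]
  let ρ : ContRepresentation ℂ (ι → κ → Circle) ℂ := ContRepresentation.ofMonoidHom ((algebraMap ℂ (ℂ →L[ℂ] ℂ)).toMonoidHom.comp χ)
  have hρapply : ∀ z x, ρ z x = χ z * x := fun z x => by
    show (algebraMap ℂ (ℂ →L[ℂ] ℂ) (χ z)) x = χ z * x
    rw [Algebra.algebraMap_eq_smul_one, _root_.smul_apply, one_apply_eq_self, smul_eq_mul]
  refine ⟨ρ, ?_, isIrreducible_of_finrank_eq_one _ (Module.finrank_self ℂ), fun g x y => ?_, fun z => by rw [hρapply, mul_one]; exact hχ z⟩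
  · show Continuous fun z => algebraMap ℂ (ℂ →L[ℂ] ℂ) (χ z)
    exact (continuous_algebraMap ℂ (ℂ →L[ℂ] ℂ)).comp hχcont
  · rw [hρapply, hρapply, ← smul_eq_mul, ← smul_eq_mul, inner_smul_left, inner_smul_right, ← mul_assoc, Complex.conj_mul', hχnorm]
    simp

/-- **A character projector of the restriction `π.restrict k` preserves every closed `π`-invariant subspace** (`P_κ v = dim • ∫ conj χ_κ(t) • π(k t) v dμT`,
each integrand in the closed subspace `Q`, `μT` a probability measure: Mathlib `Convex.integral_mem`). [cite: BrockerTomDieck1985, III (5.10)] -/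
theorem charProj_restrict_mem_closedSubrep {G T : Type*} [Group G] [Group T] [TopologicalSpace T] [IsTopologicalGroup T]
    [MeasurableSpace T] [BorelSpace T] [CompactSpace T] (μT : Measure T) [IsProbabilityMeasure μT] [μT.IsMulLeftInvariant]
    {E : Type*} [NormedAddCommGroup E] [InnerProductSpace ℂ E] [FiniteDimensional ℂ E] {κ : ContRepresentation ℂ T E}
    (hκ : Continuous (κ : T → E →L[ℂ] E))
    {V : Type*} [NormedAddCommGroup V] [InnerProductSpace ℂ V] [CompleteSpace V]
    (π : ContRepresentation ℂ G V) (k : T →* G) (hU : ∀ v, Continuous fun t => (π.restrict k) t v)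
    (Q : ContRepresentation.ClosedSubrep π) {v : V} (hv : v ∈ Q) :
    Schur.charProj μT κ (π.restrict k) v ∈ Q := by
  rw [Schur.charProj_def]
  refine Q.toSubmodule.smul_mem _ ?_
  have hconv : Convex ℝ ((Q.toSubmodule.restrictScalars ℝ : Submodule ℝ V) : Set V) := Submodule.convex _
  exact hconv.integral_mem (μ := μT) Q.isClosed' (f := fun t => conj (Schur.character κ t) • (π.restrict k) t v)
    (Filter.Eventually.of_forall fun t => Q.toSubmodule.smul_mem _ (by rw [ContRepresentation.restrict_apply]; exact Q.apply_mem (k t) hv))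
    (Schur.integrable_conj_character_smul_orbit μT hκ hU v)


/-! ## §1 The discharge (statement = the body of the junction's brick `F0LD1ThetaSliceOfBricks.TorusProjector`, v3 589c23d6 :165–:230, VERBATIM) -/

set_option maxHeartbeats 400000 in
/-- **(Gβ-P) `TorusProjector` HOLDS**: `P_β := Schur.charProjL μT κ_β ((rightRegular μ).restrict k)` (★ `F0LD1ArchTorusHom` §1 torus hom through the pin, ★
`exists_borel_haarProbability`, §0 character representation of type `n(β)` for the archimedean type `hlam.infinityType`) satisfies (i) §0
`charProj_restrict_mem_closedSubrep`, (ii) ★ `charProjL_thetaClass_eq_coeff_smul_of_hasSum_thetaClass` fed by ★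
`hasSum_follandCoeff_smul_thetaClass_follandHermite`, (iii) ★ `charProj_thetaClass_follandHermite_eq_self_of_torusPin`.
[cite: BrockerTomDieck1985, III (5.10); II (8.1)] [cite: BorelJacquet1979, §4.6] [cite: KonnoKonno2007, Thm. 5.4] [cite: Folland1989, §1.7] -/
theorem torusProjector :
  ∀ (L : Type) [Field L] [NumberField L] [IsCMField L] (ι : L →+* ℂ) (H : Matrix (Fin 2) (Fin 2) L)
      (dV : Fin 2 → L) (hdV : ∀ i, IsCMField.complexConj L (dV i) = dV i) (hdV0 : ∀ i, dV i ≠ 0)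
      (t : L) (ht : t ≠ 0) (g : GL (Fin 2) L)
      (hg : formCongr ((IsCMField.complexConj L : L ≃ₐ[↥(maximalRealSubfield L)] L) : L →+* L) g (t • H) = Matrix.diagonal dV),
      (∃ T : GL (Fin 2) ℂ, formCongr (starRingEnd ℂ) T ((Matrix.diagonal dV).map ι) = Matrix.diagonal ![(1 : ℂ), -1]) →
      ∀ (hdef : ∀ τ' : L →+* ℂ, InfinitePlace.mk τ' ≠ InfinitePlace.mk ι → ((Matrix.diagonal dV).map τ').PosDef)
        (hdeg : 4 ≤ Module.finrank ℚ L)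
        (μ : Measure (adelicGroupData (↥(maximalRealSubfield L)) L (IsCMField.complexConj L) 2 H).automorphicQuotient)
        [(adelicGroupData (↥(maximalRealSubfield L)) L (IsCMField.complexConj L) 2 H).IsAutomorphicMeasure μ]
        {n' : ℕ} (e₁ : Fin 2 × Fin 1 ≃ Fin n')
        (lam : Literature.NumberTheory.Automorphic.IdeleClassGroup L →ₜ* Circle) (hlam : IsConjugateSymplectic L lam), HasWeight L lam 1 →
      ∀ (ιA : (adelicGroupData (↥(maximalRealSubfield L)) L (IsCMField.complexConj L) 2 H).Adelic →*
          ↥(UnitaryGroup.adelic (↥(maximalRealSubfield L)) L (IsCMField.complexConj L) 2 (Matrix.diagonal dV)))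
        (hιA : ∀ k, ((ιA k : ↥(UnitaryGroup.adelic (↥(maximalRealSubfield L)) L (IsCMField.complexConj L) 2 (Matrix.diagonal dV))) :
              GL (Fin 2) (AdeleRing (𝓞 L) L)) =
            (toAdeleGL L g)⁻¹ * adelicVal (↥(maximalRealSubfield L)) L (IsCMField.complexConj L) 2 H k * toAdeleGL L g)
        [CompactSpace (↥(UnitaryGroup.adelic (↥(maximalRealSubfield L)) L (IsCMField.complexConj L) 2 (Matrix.diagonal dV)) ⧸
          (UnitaryGroup.toAdelic (↥(maximalRealSubfield L)) L (IsCMField.complexConj L) 2 (Matrix.diagonal dV)).range)]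
        (a' : (↥(maximalRealSubfield L))ˣ)
        (ξ : haveI := normal_range_toAdelic_JW L a'
          PontryaginDual (↥(UnitaryGroup.adelic (↥(maximalRealSubfield L)) L (IsCMField.complexConj L) 1 (JW (↥(maximalRealSubfield L)) L a')) ⧸ (UnitaryGroup.toAdelic (↥(maximalRealSubfield L)) L (IsCMField.complexConj L) 1 (JW (↥(maximalRealSubfield L)) L a')).range)),
        letI : MeasurableSpace (↥(UnitaryGroup.adelic (↥(maximalRealSubfield L)) L (IsCMField.complexConj L) 1 (JW (↥(maximalRealSubfield L)) L a')) ⧸ (UnitaryGroup.toAdelic (↥(maximalRealSubfield L)) L (IsCMField.complexConj L) 1 (JW (↥(maximalRealSubfield L)) L a')).range) := borel _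
        haveI := normal_range_toAdelic_JW L a'
        haveI : CompactSpace (adelicGroupData (↥(maximalRealSubfield L)) L (IsCMField.complexConj L) 2 H).automorphicQuotient :=
          (UnitaryGroup.exists_infinitePlace_ne L hdeg ι).elim fun τ hτ =>
            UnitaryGroup.compactSpace_adelicGroupData_automorphicQuotient L 2 H
              (UnitaryGroup.anisotropic_of_formCongr_smul_eq_of_posDef L 2 H dV t ht g hg τ (hdef τ hτ))
        haveI hT : Continuous ιA ∧ ∀ ⦃γ : (adelicGroupData (↥(maximalRealSubfield L)) L (IsCMField.complexConj L) 2 H).Adelic⦄,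
            γ ∈ (UnitaryGroup.toAdelic (↥(maximalRealSubfield L)) L (IsCMField.complexConj L) 2 H).range →
              ιA γ ∈ (UnitaryGroup.toAdelic (↥(maximalRealSubfield L)) L (IsCMField.complexConj L) 2 (Matrix.diagonal dV)).range :=
          ⟨continuous_of_pin L 2 H dV g ιA hιA, fun _ hγ => mem_range_toAdelic_of_pin L 2 H dV t ht g hg ιA hιA hγ⟩
        ∀ (β : ((Fin n' × {v : InfinitePlace (↥(maximalRealSubfield L)) // v.IsReal}) →₀ ℕ)), ∃ P : ((adelicGroupData (↥(maximalRealSubfield L)) L (IsCMField.complexConj L) 2 H).L2 μ) →L[ℂ] ((adelicGroupData (↥(maximalRealSubfield L)) L (IsCMField.complexConj L) 2 H).L2 μ),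
          (∀ Q : ContRepresentation.ClosedSubrep ((adelicGroupData (↥(maximalRealSubfield L)) L (IsCMField.complexConj L) 2 H).rightRegular μ), ∀ v ∈ Q, P v ∈ Q) ∧
          (∀ (hρ : HasThetaMajorants fun
          (p : ↥(UnitaryGroup.adelic (↥(maximalRealSubfield L)) L (IsCMField.complexConj L) 2 (Matrix.diagonal dV)) × ↥(UnitaryGroup.adelic (↥(maximalRealSubfield L)) L (IsCMField.complexConj L) 1 (JW (↥(maximalRealSubfield L)) L a'))) (Φ : piSchwartzBruhat (↥(maximalRealSubfield L)) (Fin n')) =>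
            pairRep (↥(maximalRealSubfield L)) L (IsCMField.complexConj L) 2 1 e₁ (Matrix.diagonal dV) (JW (↥(maximalRealSubfield L)) L a')
              (chiSplittingLine L e₁ dV hdV hdV0 (toHeckeCharacter L lam) (isUnitary_toHeckeCharacter L lam)
                ((isOscillatorChar_toHeckeCharacter_iff lam).mpr hlam) (TW (↥(maximalRealSubfield L)) a')
                (isUnit_det_TW (↥(maximalRealSubfield L)) a') (JW (↥(maximalRealSubfield L)) L a') (JW_eq (↥(maximalRealSubfield L)) L a'))
              p Φ)
            (μW : Measure (↥(UnitaryGroup.adelic (↥(maximalRealSubfield L)) L (IsCMField.complexConj L) 1 (JW (↥(maximalRealSubfield L)) L a')) ⧸ (UnitaryGroup.toAdelic (↥(maximalRealSubfield L)) L (IsCMField.complexConj L) 1 (JW (↥(maximalRealSubfield L)) L a')).range))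
        [IsFiniteMeasure μW] [SMulInvariantMeasure ↥(UnitaryGroup.adelic (↥(maximalRealSubfield L)) L (IsCMField.complexConj L) 1 (JW (↥(maximalRealSubfield L)) L a')) (↥(UnitaryGroup.adelic (↥(maximalRealSubfield L)) L (IsCMField.complexConj L) 1 (JW (↥(maximalRealSubfield L)) L a')) ⧸ (UnitaryGroup.toAdelic (↥(maximalRealSubfield L)) L (IsCMField.complexConj L) 1 (JW (↥(maximalRealSubfield L)) L a')).range) μW]
            (φ : 𝓢((Fin n' → mixedEmbedding.mixedSpace ↥(maximalRealSubfield L)), ℂ)) (Φf : FinSB (↥(maximalRealSubfield L)) (Fin n')),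
            ∃ c : ℂ, P (MemLp.toLp _ (memLp_toQuotFun_lineThetaLift L 2 H e₁ dV hdV hdV0 ιA hT lam hlam a' hρ μW
            (piSchwartzBruhatEquiv (↥(maximalRealSubfield L)) (Fin n') (φ ⊗ₜ[ℂ] Φf)) (charCM ξ) μ 2)) =
              c • MemLp.toLp _ (memLp_toQuotFun_lineThetaLift L 2 H e₁ dV hdV hdV0 ιA hT lam hlam a' hρ μW
            (piSchwartzBruhatEquiv (↥(maximalRealSubfield L)) (Fin n') (follandHermite (frameV L e₁ dV hdV hdV0 (lineW L (TW (Fp L) a')) (complexConj_lineW L (TW (Fp L) a'))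
                (lineW_ne_zero L (TW (Fp L) a') (isUnit_det_TW (Fp L) a'))) β ⊗ₜ[ℂ] Φf)) (charCM ξ) μ 2)) ∧
          (∀ (hρ : HasThetaMajorants fun
          (p : ↥(UnitaryGroup.adelic (↥(maximalRealSubfield L)) L (IsCMField.complexConj L) 2 (Matrix.diagonal dV)) × ↥(UnitaryGroup.adelic (↥(maximalRealSubfield L)) L (IsCMField.complexConj L) 1 (JW (↥(maximalRealSubfield L)) L a'))) (Φ : piSchwartzBruhat (↥(maximalRealSubfield L)) (Fin n')) =>
            pairRep (↥(maximalRealSubfield L)) L (IsCMField.complexConj L) 2 1 e₁ (Matrix.diagonal dV) (JW (↥(maximalRealSubfield L)) L a')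
              (chiSplittingLine L e₁ dV hdV hdV0 (toHeckeCharacter L lam) (isUnitary_toHeckeCharacter L lam)
                ((isOscillatorChar_toHeckeCharacter_iff lam).mpr hlam) (TW (↥(maximalRealSubfield L)) a')
                (isUnit_det_TW (↥(maximalRealSubfield L)) a') (JW (↥(maximalRealSubfield L)) L a') (JW_eq (↥(maximalRealSubfield L)) L a'))
              p Φ)
            (μW : Measure (↥(UnitaryGroup.adelic (↥(maximalRealSubfield L)) L (IsCMField.complexConj L) 1 (JW (↥(maximalRealSubfield L)) L a')) ⧸ (UnitaryGroup.toAdelic (↥(maximalRealSubfield L)) L (IsCMField.complexConj L) 1 (JW (↥(maximalRealSubfield L)) L a')).range))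
        [IsFiniteMeasure μW] [SMulInvariantMeasure ↥(UnitaryGroup.adelic (↥(maximalRealSubfield L)) L (IsCMField.complexConj L) 1 (JW (↥(maximalRealSubfield L)) L a')) (↥(UnitaryGroup.adelic (↥(maximalRealSubfield L)) L (IsCMField.complexConj L) 1 (JW (↥(maximalRealSubfield L)) L a')) ⧸ (UnitaryGroup.toAdelic (↥(maximalRealSubfield L)) L (IsCMField.complexConj L) 1 (JW (↥(maximalRealSubfield L)) L a')).range) μW]
            (Φf : FinSB (↥(maximalRealSubfield L)) (Fin n')),
            P (MemLp.toLp _ (memLp_toQuotFun_lineThetaLift L 2 H e₁ dV hdV hdV0 ιA hT lam hlam a' hρ μW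
            (piSchwartzBruhatEquiv (↥(maximalRealSubfield L)) (Fin n') (follandHermite (frameV L e₁ dV hdV hdV0 (lineW L (TW (Fp L) a')) (complexConj_lineW L (TW (Fp L) a'))
                (lineW_ne_zero L (TW (Fp L) a') (isUnit_det_TW (Fp L) a'))) β ⊗ₜ[ℂ] Φf)) (charCM ξ) μ 2)) =
              MemLp.toLp _ (memLp_toQuotFun_lineThetaLift L 2 H e₁ dV hdV hdV0 ιA hT lam hlam a' hρ μW
            (piSchwartzBruhatEquiv (↥(maximalRealSubfield L)) (Fin n') (follandHermite (frameV L e₁ dV hdV hdV0 (lineW L (TW (Fp L) a')) (complexConj_lineW L (TW (Fp L) a'))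
                (lineW_ne_zero L (TW (Fp L) a') (isUnit_det_TW (Fp L) a'))) β ⊗ₜ[ℂ] Φf)) (charCM ξ) μ 2)) := by
  intro L _ _ _ ι H dV hdV hdV0 t ht g hg _hsig hdef hdeg μ _ n' e₁ lam hlam _hw ιA hpin _ a' ξ β
  haveI : CompactSpace (adelicGroupData (↥(maximalRealSubfield L)) L (IsCMField.complexConj L) 2 H).automorphicQuotient :=
    (UnitaryGroup.exists_infinitePlace_ne L hdeg ι).elim fun τ hτ =>
      UnitaryGroup.compactSpace_adelicGroupData_automorphicQuotient L 2 H
        (UnitaryGroup.anisotropic_of_formCongr_smul_eq_of_posDef L 2 H dV t ht g hg τ (hdef τ hτ))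
  have hT : Continuous ιA ∧ ∀ ⦃γ : (adelicGroupData (↥(maximalRealSubfield L)) L (IsCMField.complexConj L) 2 H).Adelic⦄,
      γ ∈ (UnitaryGroup.toAdelic (↥(maximalRealSubfield L)) L (IsCMField.complexConj L) 2 H).range →
        ιA γ ∈ (UnitaryGroup.toAdelic (↥(maximalRealSubfield L)) L (IsCMField.complexConj L) 2 (Matrix.diagonal dV)).range :=
    ⟨continuous_of_pin L 2 H dV g ιA hpin, fun _ hγ => mem_range_toAdelic_of_pin L 2 H dV t ht g hg ιA hpin hγ⟩
  letI : MeasurableSpace (↥(UnitaryGroup.adelic (↥(maximalRealSubfield L)) L (IsCMField.complexConj L) 1 (JW (↥(maximalRealSubfield L)) L a')) ⧸ (UnitaryGroup.toAdelic (↥(maximalRealSubfield L)) L (IsCMField.complexConj L) 1 (JW (↥(maximalRealSubfield L)) L a')).range) := borel _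
  haveI : BorelSpace (↥(UnitaryGroup.adelic (↥(maximalRealSubfield L)) L (IsCMField.complexConj L) 1 (JW (↥(maximalRealSubfield L)) L a')) ⧸ (UnitaryGroup.toAdelic (↥(maximalRealSubfield L)) L (IsCMField.complexConj L) 1 (JW (↥(maximalRealSubfield L)) L a')).range) := ⟨rfl⟩
  haveI := normal_range_toAdelic_JW L a'
  -- the torus hom through the pin, the Haar probability on `T_∞`, the archimedean type, the character representation `κ_β`
  obtain ⟨k, hkc, hk, -, -⟩ := exists_continuous_archTorusHom L 2 H dV t ht g hg ιA hpin
  obtain ⟨mT, bT, μT, hprob, hinv⟩ := exists_borel_haarProbability L 2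
  letI : MeasurableSpace (({v : InfinitePlace (↥(maximalRealSubfield L)) // v.IsReal}) → Fin 2 → Circle) := mT
  haveI : BorelSpace (({v : InfinitePlace (↥(maximalRealSubfield L)) // v.IsReal}) → Fin 2 → Circle) := bT
  haveI : IsProbabilityMeasure μT := hprob
  haveI : μT.IsMulLeftInvariant := hinv
  have hτ : (toHeckeCharacter L lam).HasUnitaryArchType hlam.infinityType 0 :=
    (hasUnitaryArchType_toHeckeCharacter_iff L lam _).2 hlam.hasInfinityType_infinityType
  have hodd : ∀ w, Odd (hlam.infinityType w) := hlam.odd_infinityType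
  obtain ⟨κ, hκ, hκirr, hκu, hκc⟩ := exists_charRep_prod_prod_zpow
    (fun (v : {v : InfinitePlace (↥(maximalRealSubfield L)) // v.IsReal}) (p : Fin 2) =>
      (if 0 < signVec (cmPlaceOver L) (cmGramEntry L e₁ dV hdV (lineW L (TW (Fp L) a')) (complexConj_lineW L (TW (Fp L) a'))) (imagUnit L) v (e₁ (p, 0))
        then (hlam.infinityType (cmPlaceOver L v).1 + 1) / 2 + (β (e₁ (p, 0), v) : ℤ)
        else (hlam.infinityType (cmPlaceOver L v).1 + 1) / 2 - 1 - (β (e₁ (p, 0), v) : ℤ)))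
  haveI := hκirr
  -- orbit continuity and unitarity of `(rightRegular μ).restrict k`
  have hU : ∀ w, Continuous fun z : (({v : InfinitePlace (↥(maximalRealSubfield L)) // v.IsReal}) → Fin 2 → Circle) =>
      (((adelicGroupData (↥(maximalRealSubfield L)) L (IsCMField.complexConj L) 2 H).rightRegular μ).restrict k) z w := fun w => by
    simp only [ContRepresentation.restrict_apply]
    exact (AdelicGroupData.isStronglyContinuous_rightRegular_holds (adelicGroupData (↥(maximalRealSubfield L)) L (IsCMField.complexConj L) 2 H) μ w).comp hkc
  have hUu : ∀ (z : (({v : InfinitePlace (↥(maximalRealSubfield L)) // v.IsReal}) → Fin 2 → Circle)) (w w' : (adelicGroupData (↥(maximalRealSubfield L)) L (IsCMField.complexConj L) 2 H).L2 μ),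
      ⟪(((adelicGroupData (↥(maximalRealSubfield L)) L (IsCMField.complexConj L) 2 H).rightRegular μ).restrict k) z w,
        (((adelicGroupData (↥(maximalRealSubfield L)) L (IsCMField.complexConj L) 2 H).rightRegular μ).restrict k) z w'⟫_ℂ = ⟪w, w'⟫_ℂ :=
    fun z w w' => by
    rw [ContRepresentation.restrict_apply]
    exact (AdelicGroupData.isUnitary_rightRegular (adelicGroupData (↥(maximalRealSubfield L)) L (IsCMField.complexConj L) 2 H) μ).inner_map_map (k z) w w'
  refine ⟨Schur.charProjL μT κ (((adelicGroupData (↥(maximalRealSubfield L)) L (IsCMField.complexConj L) 2 H).rightRegular μ).restrict k) hκ hκu hU hUu,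
    fun Q v hv => ?_, fun hρ μW _ _ φ Φf => ?_, fun hρ μW _ _ Φf => ?_⟩
  · -- (i) closed invariant subspaces
    rw [Schur.charProjL_apply]
    exact charProj_restrict_mem_closedSubrep μT hκ _ k hU Q hv
  · -- (ii) extraction of the `β`-component (class currency)
    exact ⟨_, charProjL_thetaClass_eq_coeff_smul_of_hasSum_thetaClass L 2 H e₁ dV hdV hdV0 ιA hT lam hlam a' hρ μW (charCM ξ) μ hτ hodd β Φf
      k hk μT hκ hκu hκc hU hUu φ _
      (hasSum_follandCoeff_smul_thetaClass_follandHermite L 2 H e₁ dV hdV hdV0 ιA hT lam hlam a' hρ μW (charCM ξ) μ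
        (frameV L e₁ dV hdV hdV0 (lineW L (TW (Fp L) a')) (complexConj_lineW L (TW (Fp L) a'))
        (lineW_ne_zero L (TW (Fp L) a') (isUnit_det_TW (Fp L) a'))) Φf φ)⟩
  · -- (iii) the Hermite class is fixed
    rw [Schur.charProjL_apply]
    exact charProj_thetaClass_follandHermite_eq_self_of_torusPin L 2 H e₁ dV hdV hdV0 ιA hT lam hlam a' hρ μW (charCM ξ) μ hτ hodd β Φf
      k hk μT hκ hκu hκc

end Summit.HodgeConjecture.HodgeConjecture.Cruxes.HLiu418.F0LD1ThetaSliceTorusProjector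

end
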